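import Summits.NavierStokesRegularity.NavierStokesRegularity.Theorems.SwallowedContinuumRegularFibreTrivial
import HarnessLib

/-!
# Crux `NoDiscSwallow` (route SwallowedContinuum, item stmt-NavierStokesRegularity-17612), line `birth`:
# the registered stub `stub_regularFibreTrivial`

The birth skeleton `Cruxes/NoDiscSwallow/Lines/birth.lean` registers three stubs; its first,
`stub_regularFibreTrivial`, is VERBATIM the route's support item `Theses.SwallowedContinuum.RegularFibreTrivial`
(stmt-NavierStokesRegularity-17617, certified in the skeleton by `regularFibreTrivial_item_iff_stub : … := Iff.rfl`),
which is CLOSED proved by `Theorems.swallowedContinuum_regularFibreTrivial_proof`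
(`Theorems/SwallowedContinuumRegularFibreTrivial.lean`). This file lands the stub with exactly the registered
signature by instantiating that theorem. Nothing here bears on the two open stubs of the line
(`stub_noDiscSwallow_typeI`, `stub_noDiscSwallow_notTypeI`) and no Navier–Stokes regularity statement is proved.
-/

namespace Summit.NavierStokesRegularity.NavierStokesRegularity.Theorems.NoDiscSwallow.Birth

-- `<Problem> = <Summit>` duplicates `NavierStokesRegularity` in every name (lakefile sets this weakly).
set_option linter.dupNamespace false

/-- **Registered stub `stub_regularFibreTrivial` of crux item stmt-NavierStokesRegularity-17612 (line `birth`),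
exact signature.** For `ν, T > 0`, a classical solution `(u, p)` of unforced NS on `ℝ³ × [0, T)` that is
Leray–Hopf on `[0, T]` from its rapidly decaying datum, a flow map `X` of `u` on `[0, T)` (`X 0 = id`,
`∂ₛ X(s, a) = u(s, X(s, a))` within `[0, T)`) converging uniformly to `Xs` as `t ↑ T`, and a point `x` near which
`u` stays bounded up to `T` from below: the fibre `Xs ⁻¹' {x}` has at most one label.
Proof: this is the closed support item `RegularFibreTrivial` (stmt-NavierStokesRegularity-17617), i.e.
`Theorems.swallowedContinuum_regularFibreTrivial_proof`, unfolded. -/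
theorem stub_regularFibreTrivial :
    ∀ (ν T : ℝ), 0 < ν → 0 < T → ∀ (u : ℝ → EuclideanSpace ℝ (Fin 3) → EuclideanSpace ℝ (Fin 3))
    (p : ℝ → EuclideanSpace ℝ (Fin 3) → ℝ),
    Literature.Analysis.FluidPDE.IsClassicalNSSolutionOn (Set.Ico 0 T) ν 0 u p →
    Literature.Analysis.FluidPDE.IsLerayHopfOn T ν 0 (u 0) u →
    Literature.Analysis.FluidPDE.HasRapidSpatialDecay (u 0) →
    ∀ (X : ℝ → EuclideanSpace ℝ (Fin 3) → EuclideanSpace ℝ (Fin 3))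
    (Xs : EuclideanSpace ℝ (Fin 3) → EuclideanSpace ℝ (Fin 3)), (∀ a, X 0 a = a) →
    (∀ a, ∀ t ∈ Set.Ico 0 T, HasDerivWithinAt (fun s => X s a) (u t (X t a)) (Set.Ico 0 T) t) →
    TendstoUniformly X Xs (nhdsWithin T (Set.Iio T)) →
    ∀ x : EuclideanSpace ℝ (Fin 3),
    (∃ r > 0, ∃ M : ℝ, ∀ t ∈ Set.Ico (T - r ^ 2) T, ∀ y ∈ Metric.ball x r, ‖u t y‖ ≤ M) →
    (Xs ⁻¹' {x}).Subsingleton := by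
  have h := Summit.NavierStokesRegularity.NavierStokesRegularity.Theorems.swallowedContinuum_regularFibreTrivial_proof
  unfold Summit.NavierStokesRegularity.NavierStokesRegularity.Theses.SwallowedContinuum.RegularFibreTrivial at h
  exact h

end Summit.NavierStokesRegularity.NavierStokesRegularity.Theorems.NoDiscSwallow.Birth
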